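import Summits.QuantumFields.BalabanUV.Beta.GAN24.TaylorTrilinearLattice
import Summits.QuantumFields.BalabanUV.Beta.GAN24.TaylorBlockSum

/-!
# `BalabanUV.Beta.GAN24.TaylorTrilinear` — binder row G-an2-4 ∕ (CONV-C), S-slot, road «S3-Taylor», GENERIC LEAF W3
# `trilinear_taylor_bound` (`SKELETON-S3.md` v1.0 §12.7 ∕ PART III §14.2; register engine «TAYLOR-W3*»; row owner
# gan24-p1-g4 RULINGS-5 «want W3; file as `GAN24/TaylorTrilinear`» — the block-label `ℓ¹` leg currency below is the one
# RULINGS-5 ADOPTED for row W), PART 2 of 2: THE TRILINEAR DISCRETE-TAYLOR BOUND and its `LocStencil` packaging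

G-an2-4 formalisation swarm, leaf prover 19 (unit `b2b-balaban-gan24-formalise-leaf-19`, gen 13).  HONEST FRAMING (cell
rule, verbatim): «discharging `BetaPertH` makes Bałaban's UV stability UNCONDITIONAL — a real constructive-QFT result; it
is NOT the continuum limit and NOT the Clay problem.»  HONEST DEPENDENCY (verbatim): «continuum YM on T⁴ ⇐ BetaPertH ∧
nine spine estimates (0/9 proved); BetaPertH ⇐ (D1) ∧ (D4) ∧ CAP+tail; G-an2-4 gates asym, D1 and NE2/3/4.»  NOT IN
PRINT; OUR BOOKKEEPING ([folklore]): elementary real analysis on `ℤ^{d+1}` — GENERIC `d`, GENERIC blocking `N ≥ 1`,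
ABSTRACT legs `G H K` and table `T`; NO object of an2's typed `U = 1` system occurs (`e3Of`, `e3OfS`, `Sc`, `vertexOf`,
`KInv`, `wilsonA`, `wH`, `GamΦ` are not mentioned), nothing is cited, no `def … : Prop` is minted, NOTHING is asserted
or discharged of «E3Shape»∕«E3SupRate» (OPEN, not in print), of (hS, hSall), of the K-slot, of `BetaPertH`.
NOT BetaPertH, NOT continuum, NOT Clay.

CONTEXT (asserted nowhere below).  By `E3UnitSplit.e3W_unit_split` (tree) the Wilson piece of the normalised third jet
at member `n+1`, `N = Lc^{n+1}`, is `−(cE/Lc^{d+1})·N^{d−3}·[SANDWICH]`, `[SANDWICH] = Σ'_y Σ_{l′} (Σ'_w Σ_l G̃(x′;l,w)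
· Σ_κ N^{−(d+1)} Σ'_u H̃(u − N•u′)_{κκ′} · (N·wilsonA κ u w y l l′)) · H̃(y − N•z′)_{l′β}` (`G̃ = N^{d+2}GamΦ_N`,
`H̃ = N^{d+2}wH_N`); row W of the END `StencilSlotE3OfPieces.e3Shape_of_pieces` asks for an `n`-FREE `LocStencil` bound
of it.  Road «S3-Taylor» (§12.6): (N1)∕(N1′) = block-label decay `C·e^{−δ|quo N · − centre|₁}` and UNIT GRADIENTS
`(C′/N)·e^{…}` of `G̃`, `H̃` (leaf-16 `GAN24/FineReadout*`); W1 = `Σ_{w,y} wilsonA κ u w y l l′ = 0` (leaf-15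
`GAN24/WilsonVertexSumZero`); W3 = THIS FILE: with `G l w := G̃(x′;l,w)`, `H κ u := H̃(u − N•u′)_{κκ′}`, `K l′ y :=
H̃(y − N•z′)_{l′β}`, `T := wilsonA` the sandwich is `≤ C_W·e^{−(δ/2)(|x′−u′|₁+|z′−u′|₁)}`, `C_W` FREE OF `N` — the ONE
explicit `N` on the table is cashed against ONE unit gradient, the block average against the three-centre block sum
(W4 BY NAME: leaf-04's `TaylorBlockSum.abs_tsum_blockAvg_le₃`, per RULINGS-6; part 1's independent instance
`blockAvg_exp_three_le` is thereby unused here); at `d = 3` the residual `N^{d−3} = 1` and row W follows (the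
instantiation is the PART III table's, not here).

## What is proved ([folklore], `0 sorry`; `quo N` = `LatticeForm.quo`, `l1` = `B12Sec2to5.l1`, `Zl` = `ExpKernelCalculus.Zl`)
* §1 `nonneg_of_abs_le_mul_exp`, `abs_le_of_abs_le_mul_exp`; **`abs_GK_sub_le`** (ONE TERM: for `s, t ∈ B`, `|·|₁ ≤ R_B`
  on `B`, `|G l (u+s)·K l′ (u+t) − G l u·K l′ u| ≤ (R_B/N)·e^{2δR_B}·(C′_G C_K + C_G C′_K)·e^{−δ|quo N u − x′|₁}·
  e^{−δ|quo N u − z′|₁}` via `(G(u+s) − G(u))K(u+t) + G(u)(K(u+t) − K(u))` and part 1's `abs_sub_le_of_unit_steps`);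
  **`abs_slice_le`** (AT FIXED `u`: the zero row sum subtracts `G l u·K l′ u` for free; `|B|²(d+1)³` terms);
  `summable_slice` (hypothesis `hS` of part 1's `sandwich_reorder`); **`trilinear_taylor_bound`** — W3: under (hG)(hH)(hK)
  block-label decay, (hG′)(hK′) unit gradients `C′/N`, (hT0)(hTw)(hTy) a bounded table of finite range `B` in both
  offsets, (hTsum) vanishing row sums, `0 < δ`:
  `|SANDWICH| ≤ ((d+1)³·|B|²·C_T·C_H·R_B·e^{2δR_B}·(C′_G C_K + C_G C′_K)·Zl_{d+1}(δ/2)) · e^{−(δ/2)(|x′−u′|₁+|z′−u′|₁)}`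
  IN THE VERBATIM NESTING of `e3W_unit_split`'s right-hand side (weights as the reals `((N:ℝ)^(d+1))⁻¹`, `(N:ℝ)`; for
  `N = Lc^{n+1}` rewrite `((Lc:ℝ)^(n+1)) = ((Lc^(n+1) : ℕ) : ℝ)` by `Nat.cast_pow`).
* §2 **`locStencil_of_trilinear`**: a `(κ′,u′)`-indexed family whose `(inl α, inl β)` entries are `scal × SANDWICH(G α x′,
  H κ′ u′, K β z′)` and whose other entries vanish is `LocStencil S (|scal|·C_W) (δ/2)` — the literal hypothesis shape
  (hW) of `e3Shape_of_pieces` once instantiated.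
NOT HERE: (N1)∕(N1′), W1, W4 (imported BY NAME), the instantiation `G := N^{d+2}GamΦ`, `H = K := N^{d+2}wH`,
`T := wilsonA`, the residual `N^{d−3}` (row-W assembly, the table's), «E3SupRate»'s row dW (the depth-paired difference
of two such sandwiches — a separate leaf).
-/

noncomputable section

open Finset
open scoped BigOperators
open Literature.MathematicalPhysics.QuantumFieldTheory Balaban1983to89 Balaban1983to89.Beta
open B12Sec2to5 (l1 l1_nonneg)
open ExpKernelCalculus (MKer Zl)
open OneStepResolventKernel (Fib LocStencil)
open LatticeForm (quo)

namespace Summit.QuantumFields.BalabanUV.Beta.GAN24.TaylorTrilinear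

open Summit.QuantumFields.BalabanUV.Beta.GAN24.TaylorTrilinearLattice

variable {d : ℕ}

section Bound

variable (N : ℕ) [NeZero N] (G K H : Fin (d + 1) → (Fin (d + 1) → ℤ) → ℝ)
  (T : Fin (d + 1) → (Fin (d + 1) → ℤ) → (Fin (d + 1) → ℤ) → (Fin (d + 1) → ℤ) → Fin (d + 1) → Fin (d + 1) → ℝ)
  (B : Finset (Fin (d + 1) → ℤ)) (x' z' u' : Fin (d + 1) → ℤ) {δ CG CG' CK CK' CH CT RB : ℝ}

/-- [folklore] A bound `|v| ≤ C·e^{−δ r}` with `r ≥ 0`, `δ ≥ 0` forces `0 ≤ C`. -/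
theorem nonneg_of_abs_le_mul_exp {v C δ r : ℝ} (hδ : 0 ≤ δ) (hr : 0 ≤ r) (h : |v| ≤ C * Real.exp (-δ * r)) :
    0 ≤ C := by
  have h1 : Real.exp (-δ * r) ≤ 1 := Real.exp_le_one_iff.2 (by nlinarith)
  by_contra hC
  have hC' : C < 0 := lt_of_not_ge hC
  have : C * Real.exp (-δ * r) < 0 := mul_neg_of_neg_of_pos hC' (Real.exp_pos _)
  linarith [abs_nonneg v]

/-- [folklore] A bound `|v| ≤ C·e^{−δ r}` with `r ≥ 0`, `δ ≥ 0` gives `|v| ≤ C`. -/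
theorem abs_le_of_abs_le_mul_exp {v C δ r : ℝ} (hδ : 0 ≤ δ) (hr : 0 ≤ r) (h : |v| ≤ C * Real.exp (-δ * r)) :
    |v| ≤ C := by
  have hC := nonneg_of_abs_le_mul_exp hδ hr h
  exact h.trans (mul_le_of_le_one_right hC (Real.exp_le_one_iff.2 (by nlinarith)))

/-- [folklore] **THE CANCELLATION STEP, ONE TERM.**  For offsets `s, t` in the range box `B` (`|·|₁ ≤ R_B` on `B`):
`|G l (u+s)·K l′ (u+t) − G l u·K l′ u| ≤ (R_B/N)·e^{2δR_B}·(C′_G C_K + C_G C′_K)·e^{−δ|quo N u − x′|₁}·e^{−δ|quo N u − z′|₁}`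
— ONE unit gradient (`C′_G/N` or `C′_K/N`, `abs_sub_le_of_unit_steps`) on the `w`- or on the `y`-leg after
`G(u+s)K(u+t) − G(u)K(u) = (G(u+s) − G(u))·K(u+t) + G(u)·(K(u+t) − K(u))`. -/
theorem abs_GK_sub_le (hδ : 0 ≤ δ)
    (hG : ∀ l w, |G l w| ≤ CG * Real.exp (-δ * l1 (quo N w - x')))
    (hG' : ∀ l w ν, |G l (w + Pi.single ν 1) - G l w| ≤ CG' / N * Real.exp (-δ * l1 (quo N w - x')))
    (hK : ∀ l y, |K l y| ≤ CK * Real.exp (-δ * l1 (quo N y - z')))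
    (hK' : ∀ l y ν, |K l (y + Pi.single ν 1) - K l y| ≤ CK' / N * Real.exp (-δ * l1 (quo N y - z')))
    (hB : ∀ s ∈ B, l1 s ≤ RB) (u : Fin (d + 1) → ℤ) {s t : Fin (d + 1) → ℤ} (hs : s ∈ B) (ht : t ∈ B)
    (l l' : Fin (d + 1)) :
    |G l (u + s) * K l' (u + t) - G l u * K l' u| ≤
      RB / N * Real.exp (2 * δ * RB) * (CG' * CK + CG * CK') *
        (Real.exp (-δ * l1 (quo N u - x')) * Real.exp (-δ * l1 (quo N u - z'))) := by
  have hN : (0 : ℝ) < N := by exact_mod_cast Nat.pos_of_ne_zero (NeZero.ne N)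
  have hCG : 0 ≤ CG := nonneg_of_abs_le_mul_exp hδ (l1_nonneg _) (hG l u)
  have hCK : 0 ≤ CK := nonneg_of_abs_le_mul_exp hδ (l1_nonneg _) (hK l' u)
  have hCG' : 0 ≤ CG' / N := nonneg_of_abs_le_mul_exp hδ (l1_nonneg _) (hG' l u 0)
  have hCK' : 0 ≤ CK' / N := nonneg_of_abs_le_mul_exp hδ (l1_nonneg _) (hK' l' u 0)
  have hCG'0 : 0 ≤ CG' := by have h := mul_nonneg hCG' hN.le; rwa [div_mul_cancel₀ _ hN.ne'] at h
  have hCK'0 : 0 ≤ CK' := by have h := mul_nonneg hCK' hN.le; rwa [div_mul_cancel₀ _ hN.ne'] at h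
  have hsR : l1 s ≤ RB := hB s hs
  have htR : l1 t ≤ RB := hB t ht
  have hRB : 0 ≤ RB := (l1_nonneg s).trans hsR
  set ωx : ℝ := Real.exp (-δ * l1 (quo N u - x')) with hωx
  set ωz : ℝ := Real.exp (-δ * l1 (quo N u - z')) with hωz
  have hωx0 : 0 ≤ ωx := (Real.exp_pos _).le
  have hωz0 : 0 ≤ ωz := (Real.exp_pos _).le
  -- the four leg estimates at the base point `u`
  have e1 : |G l (u + s) - G l u| ≤ l1 s * (CG' / N) * Real.exp (δ * l1 s) * ωx :=
    abs_sub_le_of_unit_steps N hCG' hδ (fun z ν => hG' l z ν) u s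
  have e2 : |K l' (u + t)| ≤ CK * Real.exp (δ * l1 t) * ωz := weight_shift_le N hδ hCK u t z' (hK l' (u + t))
  have e3 : |G l u| ≤ CG * ωx := hG l u
  have e4 : |K l' (u + t) - K l' u| ≤ l1 t * (CK' / N) * Real.exp (δ * l1 t) * ωz :=
    abs_sub_le_of_unit_steps N hCK' hδ (fun z ν => hK' l' z ν) u t
  have hb1 : 0 ≤ l1 s * (CG' / N) * Real.exp (δ * l1 s) * ωx := by have := l1_nonneg s; positivity
  have hexp1 : Real.exp (δ * l1 s) ≤ Real.exp (δ * RB) := Real.exp_le_exp.2 (by nlinarith)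
  have hexp2 : Real.exp (δ * l1 t) ≤ Real.exp (δ * RB) := Real.exp_le_exp.2 (by nlinarith)
  have hexp3 : Real.exp (δ * RB) ≤ Real.exp (2 * δ * RB) := Real.exp_le_exp.2 (by nlinarith)
  have hprod : Real.exp (δ * RB) * Real.exp (δ * RB) = Real.exp (2 * δ * RB) := by rw [← Real.exp_add]; ring_nf
  calc |G l (u + s) * K l' (u + t) - G l u * K l' u|
      = |(G l (u + s) - G l u) * K l' (u + t) + G l u * (K l' (u + t) - K l' u)| := by ring_nf
    _ ≤ |G l (u + s) - G l u| * |K l' (u + t)| + |G l u| * |K l' (u + t) - K l' u| := by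
        refine (abs_add_le _ _).trans ?_
        rw [abs_mul, abs_mul]
    _ ≤ (l1 s * (CG' / N) * Real.exp (δ * l1 s) * ωx) * (CK * Real.exp (δ * l1 t) * ωz) +
          (CG * ωx) * (l1 t * (CK' / N) * Real.exp (δ * l1 t) * ωz) :=
        add_le_add (mul_le_mul e1 e2 (abs_nonneg _) hb1) (mul_le_mul e3 e4 (abs_nonneg _) (by positivity))
    _ ≤ (RB * (CG' / N) * Real.exp (δ * RB) * ωx) * (CK * Real.exp (δ * RB) * ωz) +
          (CG * ωx) * (RB * (CK' / N) * Real.exp (δ * RB) * ωz) := by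
        gcongr
    _ = RB / N * (CG' * CK * (Real.exp (δ * RB) * Real.exp (δ * RB)) + CG * CK' * Real.exp (δ * RB)) *
          (ωx * ωz) := by ring
    _ ≤ RB / N * (CG' * CK * Real.exp (2 * δ * RB) + CG * CK' * Real.exp (2 * δ * RB)) * (ωx * ωz) := by
        rw [hprod]
        have hRN : 0 ≤ RB / N := div_nonneg hRB hN.le
        gcongr
    _ = _ := by ring

/-- [folklore] **THE CANCELLATION STEP AT A FIXED VERTEX LOCATION `u`** (the zero row sum (hTsum) subtracts
`G l u · K l′ u` for free; every term then carries ONE unit gradient; `|B|²·(d+1)³` terms):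
`|Σ_{t,s∈B} Σ_{l′,l,κ} c·ν·(G l (u+s)·H κ u·T κ u (u+s) (u+t) l l′·K l′ (u+t))|
   ≤ |B|²·(d+1)³·(c·ν)·C_T·C_H·((R_B/N)·e^{2δR_B}·(C′_G C_K + C_G C′_K))·e^{−δ(|quo N u − x′|₁+|quo N u − z′|₁+|quo N u − u′|₁)}`. -/
theorem abs_slice_le {c ν : ℝ} (hc : 0 ≤ c) (hν : 0 ≤ ν) (hδ : 0 ≤ δ)
    (hG : ∀ l w, |G l w| ≤ CG * Real.exp (-δ * l1 (quo N w - x')))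
    (hG' : ∀ l w ν, |G l (w + Pi.single ν 1) - G l w| ≤ CG' / N * Real.exp (-δ * l1 (quo N w - x')))
    (hH : ∀ κ u, |H κ u| ≤ CH * Real.exp (-δ * l1 (quo N u - u')))
    (hK : ∀ l y, |K l y| ≤ CK * Real.exp (-δ * l1 (quo N y - z')))
    (hK' : ∀ l y ν, |K l (y + Pi.single ν 1) - K l y| ≤ CK' / N * Real.exp (-δ * l1 (quo N y - z')))
    (hB : ∀ s ∈ B, l1 s ≤ RB) (hT0 : ∀ κ u w y l l', |T κ u w y l l'| ≤ CT)
    (hTsum : ∀ κ u l l', ∑ s ∈ B, ∑ t ∈ B, T κ u (u + s) (u + t) l l' = 0) (u : Fin (d + 1) → ℤ) :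
    |∑ t ∈ B, ∑ s ∈ B, ∑ l' : Fin (d + 1), ∑ l : Fin (d + 1), ∑ κ : Fin (d + 1),
        c * ν * (G l (u + s) * H κ u * T κ u (u + s) (u + t) l l' * K l' (u + t))| ≤
      (B.card : ℝ) ^ 2 * ((d : ℝ) + 1) ^ 3 * (c * ν) * CT * CH *
        (RB / N * Real.exp (2 * δ * RB) * (CG' * CK + CG * CK')) *
        Real.exp (-δ * (l1 (quo N u - x') + l1 (quo N u - u') + l1 (quo N u - z'))) := by
  set ωx : ℝ := Real.exp (-δ * l1 (quo N u - x')) with hωx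
  set ωz : ℝ := Real.exp (-δ * l1 (quo N u - z')) with hωz
  set ωu : ℝ := Real.exp (-δ * l1 (quo N u - u')) with hωu
  set A : ℝ := RB / N * Real.exp (2 * δ * RB) * (CG' * CK + CG * CK') with hA
  have hCT : 0 ≤ CT := (abs_nonneg _).trans (hT0 0 u u u 0 0)
  -- the zero row sum, weighted by the `u`-diagonal values of the legs
  have hZ : ∑ t ∈ B, ∑ s ∈ B, ∑ l' : Fin (d + 1), ∑ l : Fin (d + 1), ∑ κ : Fin (d + 1),
      c * ν * (G l u * H κ u * T κ u (u + s) (u + t) l l' * K l' u) = 0 := by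
    -- push the two offset sums inside the three fibre sums, then factor the `u`-diagonal legs out of (hTsum)
    simp only [Finset.sum_comm (s := B) (t := (Finset.univ : Finset (Fin (d + 1))))]
    refine Finset.sum_eq_zero fun l' _ => Finset.sum_eq_zero fun l _ => Finset.sum_eq_zero fun κ _ => ?_
    have h0 : ∑ t ∈ B, ∑ s ∈ B, T κ u (u + s) (u + t) l l' = 0 := by rw [Finset.sum_comm]; exact hTsum κ u l l'
    calc ∑ t ∈ B, ∑ s ∈ B, c * ν * (G l u * H κ u * T κ u (u + s) (u + t) l l' * K l' u)
        = (c * ν * (G l u * H κ u * K l' u)) * ∑ t ∈ B, ∑ s ∈ B, T κ u (u + s) (u + t) l l' := by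
          rw [Finset.mul_sum]; refine Finset.sum_congr rfl fun t _ => ?_
          rw [Finset.mul_sum]; exact Finset.sum_congr rfl fun s _ => by ring
      _ = 0 := by rw [h0, mul_zero]
  rw [← sub_zero (∑ t ∈ B, _), ← hZ]
  simp only [← Finset.sum_sub_distrib]
  -- termwise: `c ν H T (G(u+s)K(u+t) − G(u)K(u))`
  have hterm : ∀ t ∈ B, ∀ s ∈ B, ∀ (l' l κ : Fin (d + 1)),
      |c * ν * (G l (u + s) * H κ u * T κ u (u + s) (u + t) l l' * K l' (u + t)) -
        c * ν * (G l u * H κ u * T κ u (u + s) (u + t) l l' * K l' u)| ≤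
        (c * ν) * CT * CH * A * (ωx * ωz * ωu) := by
    intro t ht s hs l' l κ
    have hGK := abs_GK_sub_le N G K B x' z' hδ hG hG' hK hK' hB u hs ht l l'
    have hHu := hH κ u
    have hTu := hT0 κ u (u + s) (u + t) l l'
    have hCH : 0 ≤ CH * ωu := (abs_nonneg _).trans hHu
    have hre : c * ν * (G l (u + s) * H κ u * T κ u (u + s) (u + t) l l' * K l' (u + t)) -
        c * ν * (G l u * H κ u * T κ u (u + s) (u + t) l l' * K l' u) =
        (c * ν) * (H κ u * (T κ u (u + s) (u + t) l l' * (G l (u + s) * K l' (u + t) - G l u * K l' u))) := by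
      ring
    calc |c * ν * (G l (u + s) * H κ u * T κ u (u + s) (u + t) l l' * K l' (u + t)) -
          c * ν * (G l u * H κ u * T κ u (u + s) (u + t) l l' * K l' u)|
        = (c * ν) * (|H κ u| * (|T κ u (u + s) (u + t) l l'| * |G l (u + s) * K l' (u + t) - G l u * K l' u|)) := by
          rw [hre, abs_mul, abs_of_nonneg (mul_nonneg hc hν), abs_mul, abs_mul]
      _ ≤ (c * ν) * ((CH * ωu) * (CT * (A * (ωx * ωz)))) := by
          refine mul_le_mul_of_nonneg_left ?_ (mul_nonneg hc hν)
          refine mul_le_mul hHu (mul_le_mul hTu hGK (abs_nonneg _) hCT) (by positivity) hCH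
      _ = _ := by ring
  calc |∑ t ∈ B, ∑ s ∈ B, ∑ l' : Fin (d + 1), ∑ l : Fin (d + 1), ∑ κ : Fin (d + 1),
        (c * ν * (G l (u + s) * H κ u * T κ u (u + s) (u + t) l l' * K l' (u + t)) -
          c * ν * (G l u * H κ u * T κ u (u + s) (u + t) l l' * K l' u))|
      ≤ ∑ t ∈ B, ∑ s ∈ B, ∑ l' : Fin (d + 1), ∑ l : Fin (d + 1), ∑ κ : Fin (d + 1),
        |c * ν * (G l (u + s) * H κ u * T κ u (u + s) (u + t) l l' * K l' (u + t)) -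
          c * ν * (G l u * H κ u * T κ u (u + s) (u + t) l l' * K l' u)| := by
        refine (Finset.abs_sum_le_sum_abs _ _).trans (Finset.sum_le_sum fun t _ => ?_)
        refine (Finset.abs_sum_le_sum_abs _ _).trans (Finset.sum_le_sum fun s _ => ?_)
        refine (Finset.abs_sum_le_sum_abs _ _).trans (Finset.sum_le_sum fun l' _ => ?_)
        refine (Finset.abs_sum_le_sum_abs _ _).trans (Finset.sum_le_sum fun l _ => ?_)
        exact Finset.abs_sum_le_sum_abs _ _
    _ ≤ ∑ t ∈ B, ∑ s ∈ B, ∑ l' : Fin (d + 1), ∑ l : Fin (d + 1), ∑ κ : Fin (d + 1),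
        (c * ν) * CT * CH * A * (ωx * ωz * ωu) :=
        Finset.sum_le_sum fun t ht => Finset.sum_le_sum fun s hs => Finset.sum_le_sum fun l' _ =>
          Finset.sum_le_sum fun l _ => Finset.sum_le_sum fun κ _ => hterm t ht s hs l' l κ
    _ = _ := by
        simp only [Finset.sum_const, Finset.card_univ, Fintype.card_fin, nsmul_eq_mul]
        rw [hωx, hωz, hωu, ← Real.exp_add, ← Real.exp_add]
        push_cast
        ring_nf

/-- [folklore] Summability of every `(t, s)`-slice in the vertex location (the hypothesis `hS` of
`TaylorTrilinearLattice.sandwich_reorder`), from the leg bounds: the slice is dominated by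
`(d+1)³·c·ν·C_G·C_H·C_T·C_K·e^{−δ|quo N u − u′|₁}`, summable over the fine lattice (`summable_exp_quo`). -/
theorem summable_slice {c ν : ℝ} (hc : 0 ≤ c) (hν : 0 ≤ ν) (hδ : 0 < δ)
    (hG : ∀ l w, |G l w| ≤ CG * Real.exp (-δ * l1 (quo N w - x')))
    (hH : ∀ κ u, |H κ u| ≤ CH * Real.exp (-δ * l1 (quo N u - u')))
    (hK : ∀ l y, |K l y| ≤ CK * Real.exp (-δ * l1 (quo N y - z')))
    (hT0 : ∀ κ u w y l l', |T κ u w y l l'| ≤ CT) (t s : Fin (d + 1) → ℤ) :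
    Summable fun u : Fin (d + 1) → ℤ => ∑ l' : Fin (d + 1), ∑ l : Fin (d + 1), ∑ κ : Fin (d + 1),
      c * ν * (G l (u + s) * H κ u * T κ u (u + s) (u + t) l l' * K l' (u + t)) := by
  have hCT : 0 ≤ CT := (abs_nonneg _).trans (hT0 0 t t t 0 0)
  have hCG : 0 ≤ CG := nonneg_of_abs_le_mul_exp hδ.le (l1_nonneg _) (hG 0 t)
  have hCK : 0 ≤ CK := nonneg_of_abs_le_mul_exp hδ.le (l1_nonneg _) (hK 0 t)
  refine Summable.of_norm_bounded ((summable_exp_quo N hδ u').mul_left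
    (((d : ℝ) + 1) ^ 3 * (c * ν) * CG * CH * CT * CK)) (fun u => ?_)
  rw [Real.norm_eq_abs]
  have hterm : ∀ l' l κ : Fin (d + 1),
      |c * ν * (G l (u + s) * H κ u * T κ u (u + s) (u + t) l l' * K l' (u + t))| ≤
        (c * ν) * CG * CH * CT * CK * Real.exp (-δ * l1 (quo N u - u')) := by
    intro l' l κ
    have h1 : |G l (u + s)| ≤ CG := abs_le_of_abs_le_mul_exp hδ.le (l1_nonneg _) (hG l (u + s))
    have h2 := hH κ u
    have h3 := hT0 κ u (u + s) (u + t) l l'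
    have h4 : |K l' (u + t)| ≤ CK := abs_le_of_abs_le_mul_exp hδ.le (l1_nonneg _) (hK l' (u + t))
    have hCH : 0 ≤ CH * Real.exp (-δ * l1 (quo N u - u')) := (abs_nonneg _).trans h2
    rw [abs_mul, abs_of_nonneg (mul_nonneg hc hν), abs_mul, abs_mul, abs_mul]
    calc c * ν * (|G l (u + s)| * |H κ u| * |T κ u (u + s) (u + t) l l'| * |K l' (u + t)|)
        ≤ c * ν * (CG * (CH * Real.exp (-δ * l1 (quo N u - u'))) * CT * CK) := by
          refine mul_le_mul_of_nonneg_left ?_ (mul_nonneg hc hν)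
          refine mul_le_mul (mul_le_mul (mul_le_mul h1 h2 (abs_nonneg _) hCG) h3 (abs_nonneg _)
            (mul_nonneg hCG hCH)) h4 (abs_nonneg _) (mul_nonneg (mul_nonneg hCG hCH) hCT)
      _ = _ := by ring
  calc |∑ l' : Fin (d + 1), ∑ l : Fin (d + 1), ∑ κ : Fin (d + 1),
        c * ν * (G l (u + s) * H κ u * T κ u (u + s) (u + t) l l' * K l' (u + t))|
      ≤ ∑ l' : Fin (d + 1), ∑ l : Fin (d + 1), ∑ κ : Fin (d + 1),
        |c * ν * (G l (u + s) * H κ u * T κ u (u + s) (u + t) l l' * K l' (u + t))| := by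
        refine (Finset.abs_sum_le_sum_abs _ _).trans (Finset.sum_le_sum fun l' _ => ?_)
        refine (Finset.abs_sum_le_sum_abs _ _).trans (Finset.sum_le_sum fun l _ => ?_)
        exact Finset.abs_sum_le_sum_abs _ _
    _ ≤ ∑ l' : Fin (d + 1), ∑ l : Fin (d + 1), ∑ κ : Fin (d + 1),
        (c * ν) * CG * CH * CT * CK * Real.exp (-δ * l1 (quo N u - u')) :=
        Finset.sum_le_sum fun l' _ => Finset.sum_le_sum fun l _ => Finset.sum_le_sum fun κ _ => hterm l' l κ
    _ = _ := by
        simp only [Finset.sum_const, Finset.card_univ, Fintype.card_fin, nsmul_eq_mul]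
        push_cast
        ring

/-- [folklore] **W3 — THE TRILINEAR DISCRETE-TAYLOR BOUND** (`SKELETON-S3.md` v0.6 §12.7 generic leaf W3 of road
«S3-Taylor»; register engine «TAYLOR-W3*»).  In the VERBATIM nesting of the right-hand sandwich of
`E3UnitSplit.e3W_unit_split` — three legs `G` (row, centre `x′`), `H` (vertex-location column, centre `u′`), `K`
(column, centre `z′`), the block average `(N^{d+1})⁻¹ Σ'_u`, ONE explicit factor `N` on a finite-range table `T` —
the hypotheses
* (hG)/(hH)/(hK) block-label decay `|G l w| ≤ C_G·e^{−δ|quo N w − x′|₁}` etc. (the (N1)-type leg bounds),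
* (hG′)/(hK′) UNIT GRADIENTS `|G l (w + e_ν) − G l w| ≤ (C′_G/N)·e^{−δ|quo N w − x′|₁}` on the two legs attached to the
  table's free sites (the (N1′)-type bounds),
* (hT0)/(hTw)/(hTy) a bounded table of finite range `B` in both offsets `w − u`, `y − u` (`|s|₁ ≤ R_B` on `B`),
* (hTsum) VANISHING ROW SUMS `Σ_{s,t∈B} T κ u (u+s) (u+t) l l′ = 0` (the W1-type input),
give, for `0 < δ`, the `N`-FREE bi-localised bound at the common centre `u′`:
`|Σ'_y Σ_{l′} (Σ'_w Σ_l G l w · Σ_κ (N^{d+1})⁻¹ Σ'_u H κ u · (N · T κ u w y l l′)) · K l′ y|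
   ≤ (d+1)³·|B|²·C_T·C_H·R_B·e^{2δR_B}·(C′_G C_K + C_G C′_K)·Zl_{d+1}(δ/2) · e^{−(δ/2)(|x′ − u′|₁ + |z′ − u′|₁)}`.
The one `N` is cashed against one unit gradient; the block average against the three-centre block sum. -/
theorem trilinear_taylor_bound (hδ : 0 < δ)
    (hG : ∀ l w, |G l w| ≤ CG * Real.exp (-δ * l1 (quo N w - x')))
    (hG' : ∀ l w ν, |G l (w + Pi.single ν 1) - G l w| ≤ CG' / N * Real.exp (-δ * l1 (quo N w - x')))
    (hH : ∀ κ u, |H κ u| ≤ CH * Real.exp (-δ * l1 (quo N u - u')))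
    (hK : ∀ l y, |K l y| ≤ CK * Real.exp (-δ * l1 (quo N y - z')))
    (hK' : ∀ l y ν, |K l (y + Pi.single ν 1) - K l y| ≤ CK' / N * Real.exp (-δ * l1 (quo N y - z')))
    (hB : ∀ s ∈ B, l1 s ≤ RB) (hT0 : ∀ κ u w y l l', |T κ u w y l l'| ≤ CT)
    (hTw : ∀ κ u w y l l', w - u ∉ B → T κ u w y l l' = 0)
    (hTy : ∀ κ u w y l l', y - u ∉ B → T κ u w y l l' = 0)
    (hTsum : ∀ κ u l l', ∑ s ∈ B, ∑ t ∈ B, T κ u (u + s) (u + t) l l' = 0) :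
    |∑' y : Fin (d + 1) → ℤ, ∑ l' : Fin (d + 1),
        (∑' w : Fin (d + 1) → ℤ, ∑ l : Fin (d + 1), G l w *
            ∑ κ : Fin (d + 1), ((N : ℝ) ^ (d + 1))⁻¹ * ∑' u : Fin (d + 1) → ℤ, H κ u * ((N : ℝ) * T κ u w y l l')) *
          K l' y| ≤
      (((d : ℝ) + 1) ^ 3 * (B.card : ℝ) ^ 2 * CT * CH * RB * Real.exp (2 * δ * RB) * (CG' * CK + CG * CK') *
          Zl (d + 1) (δ / 2)) * Real.exp (-(δ / 2) * (l1 (x' - u') + l1 (z' - u'))) := by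
  have hN : (0 : ℝ) < N := by exact_mod_cast Nat.pos_of_ne_zero (NeZero.ne N)
  have hc : 0 ≤ ((N : ℝ) ^ (d + 1))⁻¹ := by positivity
  -- Step 1 (part 1): reorder the sandwich into ONE lattice sum over the vertex location of finite offset sums
  rw [sandwich_reorder G K H T B (((N : ℝ) ^ (d + 1))⁻¹) (N : ℝ) hTw hTy
    (fun t _ s _ => summable_slice N G K H T x' z' u' hc hN.le hδ hG hH hK hT0 t s)]
  -- Step 2: the slice at `u` is the block average `(N^{d+1})⁻¹ · F u` of a three-leg-dominated fine family
  have hpull : ∀ u : Fin (d + 1) → ℤ,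
      (∑ t ∈ B, ∑ s ∈ B, ∑ l' : Fin (d + 1), ∑ l : Fin (d + 1), ∑ κ : Fin (d + 1),
        ((N : ℝ) ^ (d + 1))⁻¹ * (N : ℝ) * (G l (u + s) * H κ u * T κ u (u + s) (u + t) l l' * K l' (u + t))) =
      ((N : ℝ) ^ (d + 1))⁻¹ * ∑ t ∈ B, ∑ s ∈ B, ∑ l' : Fin (d + 1), ∑ l : Fin (d + 1), ∑ κ : Fin (d + 1),
        1 * (N : ℝ) * (G l (u + s) * H κ u * T κ u (u + s) (u + t) l l' * K l' (u + t)) := by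
    intro u; simp only [Finset.mul_sum, one_mul, mul_assoc]
  rw [tsum_congr hpull]
  have hF := fun u => abs_slice_le N G K H T B x' z' u' zero_le_one hN.le hδ.le hG hG' hH hK hK' hB hT0 hTsum u
  -- Step 3: W4 BY NAME (leaf-04 `TaylorBlockSum.abs_tsum_blockAvg_le₃`, root = the vertex-location centre `u′`)
  refine (TaylorBlockSum.abs_tsum_blockAvg_le₃ (N := N) hδ hF).trans (le_of_eq ?_)
  field_simp

end Bound

/-! ## §2 Packaging: W3 as a `LocStencil` bound for `(κ′, u′)`-indexed data (the hypothesis shape (hW) of the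
## owner's `StencilSlotE3OfPieces.e3Shape_of_pieces`, modulo the row-W instantiation) -/

section Pack

variable (N : ℕ) [NeZero N]
  (G H K : Fin (d + 1) → (Fin (d + 1) → ℤ) → Fin (d + 1) → (Fin (d + 1) → ℤ) → ℝ)
  (T : Fin (d + 1) → (Fin (d + 1) → ℤ) → (Fin (d + 1) → ℤ) → (Fin (d + 1) → ℤ) → Fin (d + 1) → Fin (d + 1) → ℝ)
  (B : Finset (Fin (d + 1) → ℤ)) (scal : ℝ) (S : Fin (d + 1) → (Fin (d + 1) → ℤ) → MKer (d + 1) (Fib d))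
  {δ CG CG' CK CK' CH CT RB : ℝ}

/-- [folklore] **W3 PACKAGED AS A LOCAL STENCIL FAMILY.**  A `(κ′, u′)`-indexed kernel family `S` whose field–field
entries are `scal ×` the unit sandwich of `trilinear_taylor_bound` — row leg `G α x′`, vertex-location leg `H κ′ u′`,
column leg `K β z′`, one table `T`, one offset box `B` — and whose other entries vanish (an `mm`-read has no multiplier
legs: `E3UnitSplit.e3OfS_inl_inr` ∕ `e3OfS_inr`), with the leg hypotheses UNIFORM in `(α, x′)`, `(κ′, u′)`, `(β, z′)`,
is a local stencil family: `LocStencil S (|scal|·C_W) (δ/2)` with the constant `C_W` of `trilinear_taylor_bound`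
(free of `N`; the member index of a family enters only through `scal` and the constants). -/
theorem locStencil_of_trilinear (hδ : 0 < δ)
    (hS : ∀ κ' u' x' z' α β, S κ' u' x' z' (Sum.inl α) (Sum.inl β) = scal *
      ∑' y : Fin (d + 1) → ℤ, ∑ l' : Fin (d + 1),
        (∑' w : Fin (d + 1) → ℤ, ∑ l : Fin (d + 1), G α x' l w *
            ∑ κ : Fin (d + 1), ((N : ℝ) ^ (d + 1))⁻¹ *
              ∑' u : Fin (d + 1) → ℤ, H κ' u' κ u * ((N : ℝ) * T κ u w y l l')) * K β z' l' y)
    (hSr : ∀ κ' u' x' z' α ν, S κ' u' x' z' (Sum.inl α) (Sum.inr ν) = 0)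
    (hSl : ∀ κ' u' x' z' μ b, S κ' u' x' z' (Sum.inr μ) b = 0)
    (hG : ∀ α x' l w, |G α x' l w| ≤ CG * Real.exp (-δ * l1 (quo N w - x')))
    (hG' : ∀ α x' l w ν, |G α x' l (w + Pi.single ν 1) - G α x' l w| ≤ CG' / N * Real.exp (-δ * l1 (quo N w - x')))
    (hH : ∀ κ' u' κ u, |H κ' u' κ u| ≤ CH * Real.exp (-δ * l1 (quo N u - u')))
    (hK : ∀ β z' l y, |K β z' l y| ≤ CK * Real.exp (-δ * l1 (quo N y - z')))
    (hK' : ∀ β z' l y ν, |K β z' l (y + Pi.single ν 1) - K β z' l y| ≤ CK' / N * Real.exp (-δ * l1 (quo N y - z')))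
    (hB : ∀ s ∈ B, l1 s ≤ RB) (hT0 : ∀ κ u w y l l', |T κ u w y l l'| ≤ CT)
    (hTw : ∀ κ u w y l l', w - u ∉ B → T κ u w y l l' = 0)
    (hTy : ∀ κ u w y l l', y - u ∉ B → T κ u w y l l' = 0)
    (hTsum : ∀ κ u l l', ∑ s ∈ B, ∑ t ∈ B, T κ u (u + s) (u + t) l l' = 0) :
    LocStencil S (|scal| * (((d : ℝ) + 1) ^ 3 * (B.card : ℝ) ^ 2 * CT * CH * RB * Real.exp (2 * δ * RB) *
      (CG' * CK + CG * CK') * Zl (d + 1) (δ / 2))) (δ / 2) := by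
  intro κ' u' x' z' a b
  have hmain : ∀ α β : Fin (d + 1), |S κ' u' x' z' (Sum.inl α) (Sum.inl β)| ≤
      |scal| * (((d : ℝ) + 1) ^ 3 * (B.card : ℝ) ^ 2 * CT * CH * RB * Real.exp (2 * δ * RB) *
        (CG' * CK + CG * CK') * Zl (d + 1) (δ / 2)) * Real.exp (-(δ / 2) * (l1 (x' - u') + l1 (z' - u'))) := by
    intro α β
    rw [hS, abs_mul, mul_assoc]
    exact mul_le_mul_of_nonneg_left (trilinear_taylor_bound N (G α x') (K β z') (H κ' u') T B x' z' u' hδ (hG α x')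
      (hG' α x') (hH κ' u') (hK β z') (hK' β z') hB hT0 hTw hTy hTsum) (abs_nonneg _)
  rcases a with α | μ
  · rcases b with β | ν
    · exact hmain α β
    · rw [hSr, abs_zero]; exact (abs_nonneg _).trans (hmain α α)
  · rw [hSl, abs_zero]; exact (abs_nonneg _).trans (hmain μ μ)

end Pack

end Summit.QuantumFields.BalabanUV.Beta.GAN24.TaylorTrilinear

end
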